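import Mathlib
import HarnessLib
import Literature.MathematicalPhysics.QuantumLattice.FermiRG.BGM2006Sec2Setup
import Summits.HubbardSuperconductivity.HubbardSuperconductivity.Theorems.KLProgrammeFermiSurfaceUmklapp

/-!
# Route `KLProgramme` (cruxes K3/K1, risk r2): BGM 2006 Lemma 2.1, AS TYPED in `FermiRG/BGM2006Sec2Setup.lean`
# (`BGM2006_Lemma_2_1`) — its filling regime `μ < -2 - √2` EXCLUDES both programme windows, and its
# no-umklapp clause (2.40a) is FALSE there already at scale `h = 0`

Cell `gate-hubbard-kl`, seat fs-1, risk-register item r2. The typer file `BGM2006Sec2Setup.lean` (t1) states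
Benfatto–Giuliani–Mastropietro 2006, Lemma 2.1 in tree variables: for `-4 < μ < -2 - √2` (BGM's
`μ' < μ₀ = (2 - √2)/2` in their normalisation `ε = 2 - cos - cos`) and `BGMAdmissibleE0 μ e₀`
(`0 < e₀ < -2 - √2 - μ`, `e₀ < μ + 4`), the scale-`h` curves `ε_h = μ + e` stay convex, transversal, and —
clause (3), (2.40a) — `2n ≤ 8` momenta on them never sum to a reciprocal vector: `|Σ kᵢ| < 2π`. Here:

* §1 under `BGMInitial E` (`E_0 ≡ ε₀`) the scale-0 effective dispersion IS the free band:
  `bgmEffDisp β E 0 = sqDispersion` (`klfs_bgm2006_effDisp_zero`);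
* §2 the regime hypothesis fails on both windows: `¬ (μ < -2 - √2)` and `¬ BGMAdmissibleE0 μ e₀` for every
  `e₀` once `-2 - √2 ≤ μ` (`klfs_not_bgmAdmissibleE0`, `klfs_windows_not_bgm2006_regime`);
* §3 and this restriction is NECESSARY for clause (3), not an artefact of the typing: for every `-2 ≤ μ < 0`,
  every `β` and every family `E` with `BGMInitial E`, the four scale-0 level momenta `(π/2, ±y₀)` (twice each),
  `cos y₀ = -μ/2`, lie in `[-π,π]²` on `ε_0 = μ` and sum to `(2π, 0)`, of length exactly `2π`
  (`klfs_bgm2006_clause3_fails_at_scale_zero`, from `klfs_exists_umklapp_quadruple`) — the window HAS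
  four-leg umklapp, so any K1/K3 analogue of Lemma 2.1 must drop (2.40a) (DECOMP C4b is load-bearing).

No definitions; everything PROVED. [folklore]
-/

noncomputable section

open Real Set

-- the tree's namespace `Summit.<Summit>.<Problem>.Theorems` repeats the summit name by design (D-0017)
set_option linter.dupNamespace false

namespace Summit.HubbardSuperconductivity.HubbardSuperconductivity.Theorems

open Literature.MathematicalPhysics.QuantumLattice

/-! ### §1 The scale-0 effective dispersion is the free band -/

/-- Under (2.18) `E_0 ≡ ε₀`, the effective dispersion (2.36c) at scale `0` is `ε₀ = sqDispersion`, for every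
`β`. [folklore] -/
theorem klfs_bgm2006_effDisp_zero {E : ℤ → ℝ × (Fin 2 → ℝ) → ℂ} (hE : FermiRG.BGMInitial E) (β : ℝ)
    (k : Fin 2 → ℝ) : FermiRG.bgmEffDisp β E 0 k = sqDispersion k := by
  rw [FermiRG.bgmEffDisp, hE, hE]
  push_cast
  simp

/-! ### §2 The regime `μ < -2 - √2` excludes the windows -/

/-- `BGMAdmissibleE0 μ e₀` forces `μ < -2 - √2`; so for `-2 - √2 ≤ μ` no `e₀` is admissible. [folklore] -/
theorem klfs_not_bgmAdmissibleE0 {μ : ℝ} (hμ : -2 - Real.sqrt 2 ≤ μ) (e₀ : ℝ) :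
    ¬ FermiRG.BGMAdmissibleE0 μ e₀ := by
  rintro ⟨h0, h1, -⟩
  linarith

/-- **Both programme windows lie outside BGM 2006's regime**: for `μ ∈ [-0.4267, -0.1798]` or
`μ ∈ [-1, -0.15]`, `¬ (μ < -2 - √2)` and no `e₀` is admissible — `BGM2006_Lemma_2_1` (and every typed BGM 2006
statement carrying `μ < -2 - √2`) is a TEMPLATE for K1/K3, not an instance. [folklore] -/
theorem klfs_windows_not_bgm2006_regime {μ : ℝ}
    (hμ : μ ∈ Icc (-0.4267 : ℝ) (-0.1798) ∨ μ ∈ Icc (-1 : ℝ) (-0.15)) :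
    ¬ (μ < -2 - Real.sqrt 2) ∧ ∀ e₀ : ℝ, ¬ FermiRG.BGMAdmissibleE0 μ e₀ := by
  have hs : 0 ≤ Real.sqrt 2 := Real.sqrt_nonneg 2
  have hμ' : -2 - Real.sqrt 2 ≤ μ := by
    rcases hμ with ⟨h1, -⟩ | ⟨h1, -⟩ <;> linarith
  exact ⟨fun h => absurd h (not_lt.2 hμ'), fun e₀ => klfs_not_bgmAdmissibleE0 hμ' e₀⟩

/-! ### §3 Clause (3) of Lemma 2.1 is false at scale 0 on `[-2, 0)` -/

/-- **Four-leg umklapp at scale `h = 0` for `-2 ≤ μ < 0`**, in the vocabulary of `BGM2006_Lemma_2_1` (3):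
for every inverse temperature `β` and every family `E` with `E_0 ≡ ε₀` there are `2n = 4` momenta in the zone
`[-π,π]²` on the curve `ε_0(k⃗) = μ + 0` whose sum has length `2π` — NOT `< 2π`. [folklore] -/
theorem klfs_bgm2006_clause3_fails_at_scale_zero {μ : ℝ} (hμ₁ : -2 ≤ μ) (hμ₂ : μ < 0)
    {E : ℤ → ℝ × (Fin 2 → ℝ) → ℂ} (hE : FermiRG.BGMInitial E) (β : ℝ) :
    ∃ k : Fin (2 * 2) → Fin 2 → ℝ,
      (∀ j, k j ∈ FermiRG.zoneSq ∧ FermiRG.bgmEffDisp β E 0 (k j) = μ + 0) ∧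
        ¬ Real.sqrt ((∑ j, k j 0) ^ 2 + (∑ j, k j 1) ^ 2) < 2 * π := by
  obtain ⟨k, habs, hlev, -, hsum⟩ := klfs_exists_umklapp_quadruple hμ₁ hμ₂
  refine ⟨k, fun j => ⟨?_, ?_⟩, ?_⟩
  · simp only [FermiRG.zoneSq, mem_pi, mem_univ, mem_Icc, forall_true_left]
    intro i
    have h := abs_lt.1 (habs j i)
    exact ⟨h.1.le, h.2.le⟩
  · rw [klfs_bgm2006_effDisp_zero hE, hlev j, add_zero]
  · have h0 : ∑ j, k j 0 = 2 * π := by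
      have := hsum 0; simp at this; linarith
    have h1 : ∑ j, k j 1 = 0 := by
      have := hsum 1; simpa using this
    rw [h0, h1]
    rw [show (2 * π) ^ 2 + (0 : ℝ) ^ 2 = (2 * π) ^ 2 by ring, Real.sqrt_sq (by positivity)]
    exact lt_irrefl _

/-- Window form of §3: on both programme windows, clause (3) of `BGM2006_Lemma_2_1` fails at scale 0 for
every `β` and every `E` with `BGMInitial E`. [folklore] -/
theorem klfs_windows_bgm2006_clause3_fails {μ : ℝ}
    (hμ : μ ∈ Icc (-0.4267 : ℝ) (-0.1798) ∨ μ ∈ Icc (-1 : ℝ) (-0.15))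
    {E : ℤ → ℝ × (Fin 2 → ℝ) → ℂ} (hE : FermiRG.BGMInitial E) (β : ℝ) :
    ∃ k : Fin (2 * 2) → Fin 2 → ℝ,
      (∀ j, k j ∈ FermiRG.zoneSq ∧ FermiRG.bgmEffDisp β E 0 (k j) = μ + 0) ∧
        ¬ Real.sqrt ((∑ j, k j 0) ^ 2 + (∑ j, k j 1) ^ 2) < 2 * π := by
  rcases hμ with ⟨h1, h2⟩ | ⟨h1, h2⟩
  · exact klfs_bgm2006_clause3_fails_at_scale_zero (by linarith) (by linarith) hE β
  · exact klfs_bgm2006_clause3_fails_at_scale_zero (by linarith) (by linarith) hE β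

end Summit.HubbardSuperconductivity.HubbardSuperconductivity.Theorems

end
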